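import Mathlib
import HarnessLib
import Summits.HubbardSuperconductivity.HubbardSuperconductivity.Theorems.WeakCouplingBCSKlCertTPrimeHausdorffFinite

/-!
# Route `WeakCouplingBCS` — certificate vocabulary for `WcbcsKohnLuttingerB1g` (stmt-HubbardSuperconductivity-0158):
# the GENERIC sharp speed-square floor on the hole pocket of the `t`–`t′` band (successor-docket item «(E1)-GENERIC-SPEED-FLOOR», pen (R453)(A))

Cell `gate-hubbard-kl`, seat margin-1 (g18); zero kit.  `Theorems/WeakCouplingBCSKlCertB1gTPm03D0125SpeedFloor.lean` (p722895) proved the engine row (E1)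
of the `(⅛, −0.3)` record from the sharp floor `(μ + 6/5)(26/5 − μ) ≤ ‖∇ε_{−0.3}(k)‖²` at `t′ = −3/10`.  The same `u, v` algebra is uniform in `t′`:
with `s = −2t′ ∈ (0, 1)`, `u = 1 + 2t′cos k₀`, `v = 1 + 2t′cos k₁` the level-set equation `ε_{t′}(k) = μ` reads `uv = c := 1 − t′μ`, and
`t′² ‖∇ε_{t′}(k)‖² = g(u) + g(v)` with `g(x) = (c − (1 − s)x)((1 + s)x − c) ≥ 0` on `[1 − s, 1 + s]`; the larger of `u, v` is `≥ c` (as `uv = c ≤ 1`), and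
`g(x) − g(1 + s) = ((1 + s) − x)((1 − s²)(x + 1 + s) − 2c) ≥ 0` once `c(1 + s²) ≤ (1 − s²)(1 + s)`.  Since `g(1 + s) = t′²(μ − 4t′)(4 − 4t′ − μ)`:

* **`kltp_speedSq_floor_pocket`**: for `−1/2 < t′ < 0`, `μ ≤ 0` with `(1 − t′μ)(1 + 4t′²) ≤ (1 − 4t′²)(1 − 2t′)` and every `k ∈ fermiCurve (squareDispersion 1 t′) μ`,
  `(μ − 4t′)(4 − 4t′ − μ) ≤ (2 sin k₀ (1 + 2t′cos k₁))² + (2 sin k₁ (1 + 2t′cos k₀))² = ‖∇ε_{t′}(k)‖²` — SHARP (equality at the zone-boundary points `(π, ±k₁*)` of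
  the pocket), positive exactly above the van Hove level `μ > 4t′` (`= ε_{t′}(π, 0)`), and `4 − 4t′ − μ = ε_{t′}(π, π) − μ`.  The window condition reads
  `μ ≤ −0.8235…` at `t′ = −0.3` and is implied by `μ ≤ 0` at `t′ = −0.2` and `t′ = −0.1`.
* **`kltp_isFiniteMeasure_pocket`**: on that window, strictly above the van Hove level, the Fermi-curve measure `σ[ε_{t′}, μ]` is FINITE — the analytic leaf
  «finite measure» of `KLTPAnalytic` discharged for every such `(t′, μ)` with no engine row (`klph_isFiniteMeasure_tp_of_speedSqFloor'`, p4 g19).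
* a sanity `example`: at `t′ = −3/10` the generic floor is p722895's `(μ + 6/5)(26/5 − μ)`.

No definitions; nothing here asserts a record, a margin, `K₃`, `U₀`, the window or superconductivity; a Kohn–Luttinger `O(U²)` channel statement is not ODLRO;
nothing here proves superconductivity in the Hubbard model.
References: S. Raghu, S. A. Kivelson, D. J. Scalapino, Phys. Rev. B 81 (2010) 224505, §II (6), §III (the `t`–`t′` band and its van Hove level `4t′`).
-/

noncomputable section

-- the tree's namespace `Summit.<Summit>.<Problem>.Theorems` repeats the summit name by design (D-0017)
set_option linter.dupNamespace false

namespace Summit.HubbardSuperconductivity.HubbardSuperconductivity.Theorems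

open MeasureTheory Real CwKLChiralWindow Literature.MathematicalPhysics.QuantumLattice

/-- GENERIC ALGEBRAIC CORE (`s = −2t′ ∈ (0,1)`, `u = 1 + 2t′cos k₀`, `v = 1 + 2t′cos k₁`, `c = uv = 1 − t′μ`): for `u, v ∈ [1 − s, 1 + s]`, `c ≤ 1` and
`c(1 + s²) ≤ (1 − s²)(1 + s)`, `(c − (1 − s²))((1 + s)² − c) ≤ v²(u − (1 − s))((1 + s) − u) + u²(v − (1 − s))((1 + s) − v)`. [folklore] -/
theorem kltp_speedSq_core_generic (s u v c : ℝ) (hs0 : 0 < s) (hs1 : s < 1) (hu1 : 1 - s ≤ u) (hu2 : u ≤ 1 + s)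
    (hv1 : 1 - s ≤ v) (hv2 : v ≤ 1 + s) (hc1 : c ≤ 1) (hH : c * (1 + s ^ 2) ≤ (1 - s ^ 2) * (1 + s)) (huv : u * v = c) :
    (c - (1 - s ^ 2)) * ((1 + s) ^ 2 - c) ≤
      v ^ 2 * ((u - (1 - s)) * ((1 + s) - u)) + u ^ 2 * ((v - (1 - s)) * ((1 + s) - v)) := by
  have hA : 0 ≤ v ^ 2 * ((u - (1 - s)) * ((1 + s) - u)) :=
    mul_nonneg (sq_nonneg v) (mul_nonneg (by linarith) (by linarith))
  have hA' : 0 ≤ u ^ 2 * ((v - (1 - s)) * ((1 + s) - v)) :=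
    mul_nonneg (sq_nonneg u) (mul_nonneg (by linarith) (by linarith))
  have hB : u ^ 2 * ((v - (1 - s)) * ((1 + s) - v)) = (c - (1 - s) * u) * ((1 + s) * u - c) := by
    rw [← huv]; ring
  have hB' : v ^ 2 * ((u - (1 - s)) * ((1 + s) - u)) = (c - (1 - s) * v) * ((1 + s) * v - c) := by
    rw [← huv]; ring
  have hC : ∀ x : ℝ, (c - (1 - s) * x) * ((1 + s) * x - c) - (c - (1 - s ^ 2)) * ((1 + s) ^ 2 - c)
      = ((1 + s) - x) * ((1 - s ^ 2) * (x + 1 + s) - 2 * c) := fun x => by ring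
  have hs2 : 0 < 1 - s ^ 2 := by nlinarith
  have hu0 : 0 < u := by linarith
  have hv0 : 0 < v := by linarith
  -- the larger of `u`, `v` is `≥ c`
  have key : ∀ x y : ℝ, 0 < x → 1 - s ≤ x → x ≤ 1 + s → y ≤ x → x * y = c →
      (c - (1 - s ^ 2)) * ((1 + s) ^ 2 - c) ≤ (c - (1 - s) * x) * ((1 + s) * x - c) := by
    intro x y hx0 hx1 hx2 hyx hxy
    have hcx2 : c ≤ x * x := by rw [← hxy]; exact mul_le_mul_of_nonneg_left hyx hx0.le
    have hcx : c ≤ x := by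
      rcases le_or_gt 1 x with h1 | h1
      · exact hc1.trans h1
      · nlinarith
    have hD : 0 ≤ ((1 + s) - x) * ((1 - s ^ 2) * (x + 1 + s) - 2 * c) := by
      apply mul_nonneg (by linarith)
      nlinarith [mul_le_mul_of_nonneg_left hcx hs2.le]
    linarith [hC x, hD]
  rcases le_total v u with hvu | huv'
  · have h := key u v hu0 hu1 hu2 hvu huv
    linarith [hA, hB]
  · have h := key v u hv0 hv1 hv2 huv' (by rw [mul_comm]; exact huv)
    linarith [hA', hB']

/-- **GENERIC SHARP SPEED-SQUARE FLOOR on the hole pocket of the `t`–`t′` band** `ε_{t′}(k) = −2(cos k₀ + cos k₁) − 4t′cos k₀ cos k₁`, `−1/2 < t′ < 0`: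
for `μ ≤ 0` with `(1 − t′μ)(1 + 4t′²) ≤ (1 − 4t′²)(1 − 2t′)` (at `t′ = −3/10`: `μ ≤ −0.8235…`; the bound is informative above the van Hove level `μ > 4t′`,
where the left side is positive, and trivially true below it) and every
`k ∈ fermiCurve (squareDispersion 1 t′) μ`, `(μ − 4t′)(4 − 4t′ − μ) ≤ ‖∇ε_{t′}(k)‖² = (2 sin k₀ (1 + 2t′cos k₁))² + (2 sin k₁ (1 + 2t′cos k₀))²` — with equality at the
zone-boundary points `(π, ±k₁*)` of the pocket, and vanishing exactly at the van Hove level (successor-docket item «(E1)-GENERIC-SPEED-FLOOR», pen (R453)(A)).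
[cite: RaghuKivelsonScalapino2010, §III] -/
theorem kltp_speedSq_floor_pocket {tp μ : ℝ} (htp1 : -1 / 2 < tp) (htp2 : tp < 0) (hμ2 : μ ≤ 0)
    (hH : (1 - tp * μ) * (1 + 4 * tp ^ 2) ≤ (1 - 4 * tp ^ 2) * (1 - 2 * tp)) {k : Momentum}
    (hk : k ∈ fermiCurve (squareDispersion 1 tp) μ) :
    (μ - 4 * tp) * (4 - 4 * tp - μ) ≤
      (2 * sin (k 0) * (1 + 2 * tp * cos (k 1))) ^ 2 + (2 * sin (k 1) * (1 + 2 * tp * cos (k 0))) ^ 2 := by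
  obtain ⟨-, hε⟩ := hk
  simp only [squareDispersion] at hε
  set a := cos (k 0) with ha
  set b := cos (k 1) with hb
  have ha1 : -1 ≤ a := neg_one_le_cos _
  have ha2 : a ≤ 1 := cos_le_one _
  have hb1 : -1 ≤ b := neg_one_le_cos _
  have hb2 : b ≤ 1 := cos_le_one _
  have hs0' : sin (k 0) ^ 2 = 1 - a ^ 2 := by rw [ha]; exact Real.sin_sq (k 0)
  have hs1' : sin (k 1) ^ 2 = 1 - b ^ 2 := by rw [hb]; exact Real.sin_sq (k 1)
  -- the core in `u = 1 + 2t′a`, `v = 1 + 2t′b`, `s = −2t′`, `c = 1 − t′μ`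
  have huv : (1 + 2 * tp * a) * (1 + 2 * tp * b) = 1 - tp * μ := by linear_combination (-tp) * hε
  have hcore := kltp_speedSq_core_generic (-2 * tp) (1 + 2 * tp * a) (1 + 2 * tp * b) (1 - tp * μ)
    (by linarith) (by linarith) (by nlinarith) (by nlinarith) (by nlinarith) (by nlinarith) (by nlinarith)
    (by nlinarith) huv
  -- identities: `t′² · ‖∇ε‖² = v²(u−(1−s))((1+s)−u) + u²(…)` and `t′² · floor = (c − (1−s²))((1+s)² − c)`
  have hid : tp ^ 2 * ((2 * sin (k 0) * (1 + 2 * tp * cos (k 1))) ^ 2 + (2 * sin (k 1) * (1 + 2 * tp * cos (k 0))) ^ 2)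
      = (1 + 2 * tp * b) ^ 2 * (((1 + 2 * tp * a) - (1 - -2 * tp)) * ((1 + -2 * tp) - (1 + 2 * tp * a)))
        + (1 + 2 * tp * a) ^ 2 * (((1 + 2 * tp * b) - (1 - -2 * tp)) * ((1 + -2 * tp) - (1 + 2 * tp * b))) := by
    rw [← ha, ← hb]
    have e : (2 * sin (k 0) * (1 + 2 * tp * b)) ^ 2 + (2 * sin (k 1) * (1 + 2 * tp * a)) ^ 2
        = 4 * sin (k 0) ^ 2 * (1 + 2 * tp * b) ^ 2 + 4 * sin (k 1) ^ 2 * (1 + 2 * tp * a) ^ 2 := by ring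
    rw [e, hs0', hs1']; ring
  have hfl : tp ^ 2 * ((μ - 4 * tp) * (4 - 4 * tp - μ)) = (1 - tp * μ - (1 - (-2 * tp) ^ 2)) * ((1 + -2 * tp) ^ 2 - (1 - tp * μ)) := by
    ring
  have htp0 : 0 < tp ^ 2 := by nlinarith
  have h := hcore
  rw [← hfl, ← hid] at h
  exact le_of_mul_le_mul_left h htp0

/-- Sanity: at `t′ = −3/10` the generic floor is the one of `kltp_m03_speedSq_floor` (`(μ + 6/5)(26/5 − μ)`) for `μ ≤ −21/25`
(the generic window condition `(1 + (3/10)μ)(34/25) ≤ (16/25)(8/5)` reads `μ ≤ −0.8235…`). [folklore] -/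
example {μ : ℝ} (hμ2 : μ ≤ -21 / 25) {k : Momentum} (hk : k ∈ fermiCurve (squareDispersion 1 (-3 / 10)) μ) :
    (μ + 6 / 5) * (26 / 5 - μ) ≤
      (2 * sin (k 0) * (1 + 2 * (-3 / 10 : ℝ) * cos (k 1))) ^ 2 + (2 * sin (k 1) * (1 + 2 * (-3 / 10 : ℝ) * cos (k 0))) ^ 2 := by
  have h := kltp_speedSq_floor_pocket (tp := -3 / 10) (μ := μ) (by norm_num) (by norm_num) (by linarith)
    (by norm_num; linarith) hk
  have e : (μ - 4 * (-3 / 10 : ℝ)) * (4 - 4 * (-3 / 10 : ℝ) - μ) = (μ + 6 / 5) * (26 / 5 - μ) := by ring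
  linarith [e]

/-- **The Fermi-curve measure of the `t`–`t′` band is FINITE on the hole-pocket window** `4t′ < μ ≤ 0`, `(1 − t′μ)(1 + 4t′²) ≤ (1 − 4t′²)(1 − 2t′)`,
`−1/2 < t′ < 0` — the «finite measure» leaf of `KLTPAnalytic` with NO engine row (speed floor `(μ − 4t′)(4 − 4t′ − μ) > 0` + finite length).
[cite: RaghuKivelsonScalapino2010, §II (6)] -/
theorem kltp_isFiniteMeasure_pocket {tp μ : ℝ} (htp1 : -1 / 2 < tp) (htp2 : tp < 0) (hμ1 : 4 * tp < μ) (hμ2 : μ ≤ 0)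
    (hH : (1 - tp * μ) * (1 + 4 * tp ^ 2) ≤ (1 - 4 * tp ^ 2) * (1 - 2 * tp)) :
    IsFiniteMeasure (fermiCurveMeasure (squareDispersion 1 tp) μ) :=
  klph_isFiniteMeasure_tp_of_speedSqFloor' tp μ (w := (μ - 4 * tp) * (4 - 4 * tp - μ)) (mul_pos (by linarith) (by linarith))
    fun _ hk => kltp_speedSq_floor_pocket htp1 htp2 hμ2 hH hk

end Summit.HubbardSuperconductivity.HubbardSuperconductivity.Theorems

end
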